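import Literature.AlgebraicGeometry.Resolution.QuadraticTransforms
import HarnessLib

/-!
# Transport of quadratic transforms along a field embedding

Topic: `Literature/AlgebraicGeometry/Resolution`. Abhyankar's factorization theorem and its
corollary `AbhyankarQuadraticFactorization.exists_eq_of_dominated` (`QuadraticTransforms.lean`)
speak of local rings OF a field `K` (with quotient field the ambient type `K`). In Cutkosky's
counterexample the rings `A_i` are local rings of the subfield `K = k(u,v)` of the ambient
`K* = k(x,y)`; this file transports the notions along an injective ring homomorphism of fields
`ι : K₀ →+* L` (pull-back `Subring.comap ι` of subrings of `L` contained in the range of `ι`):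
local / regular / Krull dimension / domination / "local ring of the range" / quadratic transform,
and packages the corollary for a tower of subrings of `L` inside `range ι`
(`AbhyankarQuadraticFactorization.exists_eq_of_dominated_of_le_range`). All [folklore]; PROVED.
-/

noncomputable section

namespace Literature.AlgebraicGeometry.Resolution

universe u

open IsLocalRing

variable {K₀ L : Type u} [Field K₀] [Field L] (ι : K₀ →+* L)

/-! ## Pull-back of a subring contained in the range is isomorphic to it -/

/-- For `T ≤ range ι`, `ι` restricts to a ring isomorphism `T.comap ι ≃+* T`. [folklore] -/
def comapEquivOfLeRange (T : Subring L) (hT : T ≤ ι.range) : T.comap ι ≃+* T :=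
  (Subring.equivMapOfInjective (T.comap ι) ι ι.injective).trans
    (RingEquiv.subringCongr (Subring.map_comap_eq_self hT))

/-- The isomorphism is `ι` on elements. [folklore] -/
@[simp] theorem coe_comapEquivOfLeRange (T : Subring L) (hT : T ≤ ι.range) (z : T.comap ι) :
    ((comapEquivOfLeRange ι T hT z : T) : L) = ι z := rfl

variable {ι}

/-- Pull-back preserves being a local ring. [folklore] -/
theorem isLocalRing_comap {T : Subring L} (hT : T ≤ ι.range) [IsLocalRing T] :
    IsLocalRing (T.comap ι) :=
  (comapEquivOfLeRange ι T hT).symm.isLocalRing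

/-- Pull-back preserves regularity. [folklore] -/
theorem isRegularLocalRing_comap {T : Subring L} (hT : T ≤ ι.range) (h : IsRegularLocalRing T) :
    IsRegularLocalRing (T.comap ι) :=
  IsRegularLocalRing.of_ringEquiv (comapEquivOfLeRange ι T hT).symm

/-- Pull-back preserves the Krull dimension. [folklore] -/
theorem ringKrullDim_comap {T : Subring L} (hT : T ≤ ι.range) :
    ringKrullDim (T.comap ι) = ringKrullDim T :=
  ringKrullDim_eq_of_ringEquiv (comapEquivOfLeRange ι T hT)

/-- Pull-back is monotone. [folklore] -/
theorem comap_mono' {T T' : Subring L} (h : T ≤ T') : T.comap ι ≤ T'.comap ι :=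
  fun _ hz => h hz

/-- Membership in the maximal ideal is preserved by the isomorphism `T.comap ι ≃+* T`. [folklore] -/
theorem mem_maximalIdeal_comap_iff {T : Subring L} (hT : T ≤ ι.range) [IsLocalRing T]
    (z : T.comap ι) :
    (haveI := isLocalRing_comap (ι := ι) hT; z ∈ maximalIdeal (T.comap ι)) ↔
      comapEquivOfLeRange ι T hT z ∈ maximalIdeal T := by
  haveI := isLocalRing_comap (ι := ι) hT
  rw [IsLocalRing.mem_maximalIdeal, IsLocalRing.mem_maximalIdeal, mem_nonunits_iff, mem_nonunits_iff,
    not_iff_not]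
  exact (MulEquiv.isUnit_map (comapEquivOfLeRange ι T hT)).symm

/-- Pull-back preserves domination. [folklore] -/
theorem subringDominates_comap {R S : Subring L} (h : SubringDominates R S) :
    SubringDominates (R.comap ι) (S.comap ι) := by
  refine ⟨comap_mono' h.1, fun z hz hzinv => ?_⟩
  rw [Subring.mem_comap] at hz hzinv ⊢
  rw [map_inv₀] at hzinv ⊢
  exact h.2 _ hz hzinv

/-- A local `R ≤ range ι` of which every element of the range is a fraction pulls back to a
local ring OF `K₀`. [folklore] -/
theorem isLocalRingOf_comap {R : Subring L} (hR : R ≤ ι.range) [IsLocalRing R]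
    (hfrac : ∀ z : K₀, ∃ a ∈ R, ∃ b ∈ R, b ≠ 0 ∧ ι z = a / b) : IsLocalRingOf (R.comap ι) := by
  refine ⟨isLocalRing_comap hR, fun z => ?_⟩
  obtain ⟨a, ha, b, hb, hb0, hz⟩ := hfrac z
  obtain ⟨a₀, rfl⟩ := hR ha
  obtain ⟨b₀, rfl⟩ := hR hb
  refine ⟨a₀, ha, b₀, hb, fun h => hb0 (by rw [h, map_zero]), ι.injective ?_⟩
  rw [hz, map_div₀]

/-- **Pull-back preserves quadratic transforms** (for a target inside the range of `ι`): the
generator `x`, the blow-up ring `R[𝔪_R/x]` and the fraction representations all pull back.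
[folklore] -/
theorem isQuadraticTransform_comap {R R₁ : Subring L} (hR₁ : R₁ ≤ ι.range)
    (h : IsQuadraticTransform R R₁) : IsQuadraticTransform (R.comap ι) (R₁.comap ι) := by
  obtain ⟨hloc, x, hx, hx0, hloc₁, hT, hfrac, hdom⟩ := h
  haveI := hloc
  haveI := hloc₁
  have hR : R ≤ ι.range := hdom.1.trans hR₁
  haveI hl : IsLocalRing (R.comap ι) := isLocalRing_comap hR
  set e := comapEquivOfLeRange ι R hR
  -- the generator pulled back
  set x' : R.comap ι := e.symm x with hx'def
  have hex' : e x' = x := e.apply_symm_apply x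
  have hιx' : ι (x' : K₀) = (x : L) := by
    rw [← coe_comapEquivOfLeRange ι R hR x', hex']
  have hx' : x' ∈ maximalIdeal (R.comap ι) := by
    rw [mem_maximalIdeal_comap_iff hR, hex']; exact hx
  have hx'0 : x' ≠ 0 := by
    intro h0
    apply hx0
    rw [← hex', h0, map_zero]
  have hx0' : ((x : R) : L) ≠ 0 := fun h0 => hx0 (Subtype.ext h0)
  -- the blow-up ring pulls back into the blow-up ring
  have hgen : ((R : Set L) ∪ (fun y : R => (y : L) / x) '' (maximalIdeal R : Set R)) ⊆
      ι '' (((R.comap ι : Subring K₀) : Set K₀) ∪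
        (fun y : R.comap ι => (y : K₀) / x') '' (maximalIdeal (R.comap ι) : Set (R.comap ι))) := by
    rintro z (hz | ⟨y, hy, rfl⟩)
    · obtain ⟨z₀, rfl⟩ := hR hz
      exact ⟨z₀, Or.inl hz, rfl⟩
    · refine ⟨(e.symm y : K₀) / x', Or.inr ⟨e.symm y, ?_, rfl⟩, ?_⟩
      · change e.symm y ∈ maximalIdeal (R.comap ι)
        rw [mem_maximalIdeal_comap_iff hR, e.apply_symm_apply]; exact hy
      · rw [map_div₀, hιx', ← coe_comapEquivOfLeRange ι R hR (e.symm y), e.apply_symm_apply]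
  have key : (blowupRing R (x : L)).comap ι ≤ blowupRing (R.comap ι) (x' : K₀) := by
    intro z hz
    rw [Subring.mem_comap] at hz
    have h1 : blowupRing R (x : L) ≤ (blowupRing (R.comap ι) (x' : K₀)).map ι := by
      unfold blowupRing
      rw [RingHom.map_closure]
      exact Subring.closure_mono hgen
    obtain ⟨z₀, hz₀, hzz⟩ := h1 hz
    rwa [← ι.injective hzz]
  refine ⟨hl, x', hx', hx'0, isLocalRing_comap hR₁, ?_, ?_, subringDominates_comap hdom⟩
  · -- `R'[𝔪/x'] ⊆ R₁'`
    refine Subring.closure_le.mpr ?_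
    rintro z (hz | ⟨y, hy, rfl⟩)
    · exact comap_mono' hdom.1 hz
    · rw [SetLike.mem_coe, Subring.mem_comap, map_div₀, hιx']
      have hy' : e y ∈ maximalIdeal R := (mem_maximalIdeal_comap_iff hR y).mp hy
      have := hT (div_mem_blowupRing (x : L) hy')
      rwa [coe_comapEquivOfLeRange] at this
  · -- fractions
    intro z hz
    rw [Subring.mem_comap] at hz
    obtain ⟨a, ha, b, hb, hbinv, hzab⟩ := hfrac _ hz
    obtain ⟨a₀, rfl⟩ := (hT.trans hR₁) ha
    obtain ⟨b₀, rfl⟩ := (hT.trans hR₁) hb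
    refine ⟨a₀, key ha, b₀, key hb, ?_, ι.injective ?_⟩
    · rw [Subring.mem_comap, map_inv₀]; exact hbinv
    · rw [hzab, map_div₀]

/-- The subring of a pulled-back valuation ring is the pulled-back subring. [folklore] -/
theorem toSubring_comap_valuationSubring (O : ValuationSubring L) :
    (O.comap ι).toSubring = O.toSubring.comap ι := rfl

/-- **Abhyankar's classification inside a subfield**: granted Abhyankar's factorization theorem,
for a tower `R₀ → R₁ → ⋯` of quadratic transforms of two-dimensional regular local rings of `L`
all contained in the range of a field embedding `ι : K₀ → L`, with `R₀` a local ring OF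
`range ι` and every `R_{i+1}` dominated by the valuation ring `O`, every two-dimensional regular
local ring `S ≤ range ι` dominating `R₀` and dominated by `O` is one of the `R_n`
(pull back to `K₀`, apply `exists_eq_of_dominated`, push forward). [folklore] -/
theorem AbhyankarQuadraticFactorization.exists_eq_of_dominated_of_le_range
    (hF : AbhyankarQuadraticFactorization.{u}) {O : ValuationSubring L} {R : ℕ → Subring L}
    (hreg : ∀ i, IsRegularLocalRing (R i)) (hdim : ringKrullDim (R 0) = 2)
    (hrange : ∀ i, R i ≤ ι.range)
    (hfrac : ∀ z : K₀, ∃ a ∈ R 0, ∃ b ∈ R 0, b ≠ 0 ∧ ι z = a / b)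
    (hstep : ∀ i, IsQuadraticTransform (R i) (R (i + 1)) ∧ SubringDominates (R (i + 1)) O.toSubring)
    {S : Subring L} (hS : IsRegularLocalRing S) (hSdim : ringKrullDim S = 2) (hSr : S ≤ ι.range)
    (hRS : SubringDominates (R 0) S) (hSO : SubringDominates S O.toSubring) :
    ∃ n, S = R n := by
  haveI := fun i => hreg i
  have hreg' : ∀ i, IsRegularLocalRing ((R i).comap ι) := fun i => isRegularLocalRing_comap (hrange i) (hreg i)
  have hstep' : ∀ i, IsQuadraticTransformAlong (O.comap ι) ((R i).comap ι) ((R (i + 1)).comap ι) := by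
    intro i
    haveI := hreg' i
    refine (isQuadraticTransform_comap (hrange (i + 1)) (hstep i).1).along
      ⟨inferInstance, IsNoetherian.noetherian _⟩ ?_
    rw [toSubring_comap_valuationSubring]
    exact subringDominates_comap (hstep i).2
  obtain ⟨n, hn⟩ := AbhyankarQuadraticFactorization.exists_eq_of_dominated hF (O := O.comap ι)
    (R := fun i => (R i).comap ι) (hreg' 0) (by rw [ringKrullDim_comap (hrange 0)]; exact hdim)
    (isLocalRingOf_comap (hrange 0) hfrac) hstep' (S := S.comap ι) (isRegularLocalRing_comap hSr hS)
    (by rw [ringKrullDim_comap hSr]; exact hSdim) (subringDominates_comap hRS)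
    (by rw [toSubring_comap_valuationSubring]; exact subringDominates_comap hSO)
  refine ⟨n, ?_⟩
  rw [← Subring.map_comap_eq_self hSr, ← Subring.map_comap_eq_self (hrange n)]
  exact congrArg (Subring.map ι) hn

end Literature.AlgebraicGeometry.Resolution

end
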